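import Mathlib.Tactic.Module
import Literature.AlgebraicGeometry.HodgeTheory.WeilClassesIsogenyDescent
import Literature.AlgebraicGeometry.HodgeTheory.HardLefschetzThreefold
import Literature.AlgebraicGeometry.HodgeTheory.DiagonalSymmetryStability
import Literature.AlgebraicGeometry.HodgeTheory.GysinFormalismHodge
import Literature.AlgebraicGeometry.Motives.AbelianVarietyProduct
import HarnessLib

/-!
# Weil classes on products: Schoen's product step, upward half (Schoen 1998 §10; Markman §11.5 Step 2)

Family `hodge`, layer `Literature/AlgebraicGeometry/HodgeTheory`. Sibling proof file of
`WeilClasses` / `WeilClassesFourfolds` / `WeilClassesIsogenyDescent`. The named fact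
`Markman2025_weilClasses_algebraic_abelianFourfold` (rational `(2,2)`-classes in the Weil plane of a
complex abelian fourfold with `φ ≫ φ = -d` are algebraic) is NOT discharged here and this file
introduces NO named fact: it PROVES, on the real carriers of the layer, the half of the PRODUCT
STEP of the printed proof that the tree can now state — the passage from Weil classes on two
abelian varieties `A₁`, `A₂` with complex multiplication by the same `K = ℚ(√-d)` to Weil classes on
an abelian variety `B` mapping `K`-equivariantly to both (the product `A₁ × A₂`, or anything
isogenous to it), and the algebraicity of the resulting Weil component GIVEN the algebraicity of the
rational `(n,n)` Weil classes of `(B, ψ)` — in every pair of dimensions.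

## The printed step (sources read, held)

E. Markman, arXiv:2509.23403, §11.5 Step 2 (arXiv v2 PDF p. 21, lines 40–49 = v1 p. 21, lines 20–29; the text below is the held TeX-derived
corpus chunk p0019, lines 24–26 — "p. 19" is that chunk, not a PDF page — and where it has "[schoen]" the PDF
prints "[S2, Prop. 10]"), verbatim: "for every
polarized abelian fourfold `(A₁,η₁,h₁)` of Weil type, of arbitrary discriminant, there exists a
polarized abelian surface of Weil type `(A₂,η₂,h₂)`, such that the discriminant of their product
polarized abelian sixfold of Weil type `(A₁ × A₂, η, π₁^*h₁ + π₂^*h₂)` is the coset of `-1`. The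
sixfold is hence of split type and so its Weil classes are algebraic. It follows that the Weil
classes of `(A₁,η₁,h₁)` are algebraic, by [schoen]." — and [schoen] is
C. Schoen, *Addendum to: Hodge classes on self-products of a variety with an automorphism*,
Compositio Math. 114 (1998) 329–336, whose §10 PROPOSITION (p. 332) is exactly this inference
("Suppose that for each Abelian variety in the associated 'universal' family [of Weil type
sixfolds], the Weil cohomology is generated by classes of codimension 3 algebraic cycles. Then the
Weil cohomology of `A`, `W_A`, is generated by classes of codimension 2 algebraic cycles."), with
proof (p. 333), verbatim: "the Weil cohomology, `W_{A×A'}`, is generated by cohomology classes of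
algebraic cycles. We claim that `W_A` is generated by cohomology classes of algebraic cycles of the
form `pr_{A*}(z · (A × D))` where `cl(z) ∈ W_{A×A'}` and `cl(D) ∈ W_{A'}`. To check this, it is
only necessary to show that the cup product in the following diagram is surjective:
`W_{A×A'} ⊗ (H⁰(A) ⊗ W_{A'}) →∪ W_A ⊗ H⁴(A') →pr_{A*} W_A`. This follows from an explicit
computation with differential forms … bases … `W_A ⊗_ℚ ℂ : {ω_{1,σᵢ} ∧ ⋯ ∧ ω_{4,σᵢ}}_{1≤i≤2}`;
`W_{A'} ⊗_ℚ ℂ : {ω_{5,σᵢ} ∧ ω_{6,σᵢ}}_{1≤i≤2}`; `W_{A×A'} ⊗_ℚ ℂ : {ω_{1,σᵢ} ∧ ⋯ ∧ ω_{6,σᵢ}}_{1≤i≤2}`."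

On the carriers of `WeilClasses` the two basis lines `{ω_{1,σᵢ} ∧ ⋯}` of `W ⊗ ℂ` are the Weil
eigen-lines `E₊ = weilClassesPlus`, `E₋ = weilClassesMinus` (simultaneous eigenclasses of the
pull-backs `(x·𝟙 + y·φ)^*` for the characters `(x ± iy√d)^{2n}`), and Schoen's display
`ω_{1,σ} ∧ ⋯ ∧ ω_{6,σ} = (ω_{1,σ} ∧ ⋯ ∧ ω_{4,σ}) ∧ (ω_{5,σ} ∧ ω_{6,σ})` reads:
`pr₁^* E_±(A₁) ∪ pr₂^* E_±(A₂) ⊆ E_±(A₁ × A₂)` (same sign), while the mixed products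
`pr₁^* E_±(A₁) ∪ pr₂^* E_∓(A₂)` are eigenclasses of the two OTHER characters
`(x ± iy√d)^{2n₁} (x ∓ iy√d)^{2n₂}` — they lie outside `W_{A×A'} ⊗ ℂ`.

## What is proved (real carriers; `B` with `ψ`, `Aᵢ` with `φᵢ`, `pᵢ : B ⟶ Aᵢ`, `pᵢ ≫ φᵢ = ψ ≫ pᵢ`)

* `cupProduct_mem_pullbackEigenclasses` — cup products of simultaneous eigenclasses of `(B, ψ)`
  are eigenclasses for the product character (naturality of `∪`, Hatcher Prop. 3.10);
  `cupProduct_mem_weilClassesPlus` / `…Minus`: `E₊(B, n₁) ∪ E₊(B, n₂) ⊆ E₊(B, n₁ + n₂)`.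
* `cupProduct_map_map_mem_weilClassesPlus` / `…Minus` / `weilComponent_mem_weilClassesOf` —
  Schoen's basis statement: `p₁^* E_±(A₁, n₁) ∪ p₂^* E_±(A₂, n₂) ⊆ E_±(B, n₁ + n₂)`, hence the
  WEIL COMPONENT `p₁^*u₁ ∪ p₂^*u₂ + p₁^*v₁ ∪ p₂^*v₂` of the exterior product of two Weil classes
  `wᵢ = uᵢ + vᵢ` (`uᵢ ∈ E₊(Aᵢ)`, `vᵢ ∈ E₋(Aᵢ)`) lies in the Weil plane `weilClassesOf B ψ (n₁+n₂) d`
  (`W_{A₁} ⊗_K W_{A₂} → W_{A₁×A₂}`); `cupProduct_map_map_mem_pullbackEigenclasses` for the two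
  mixed terms.
* `weilComponent_cupProduct_mem_algebraicClasses` — **the upward half of Schoen's Proposition on
  carriers**: if every RATIONAL class of Hodge type `(n, n)` in the Weil plane of `(B, ψ)`
  (`n = n₁ + n₂`) is algebraic — the hypothesis "the Weil cohomology `W_{A×A'}` is generated by
  classes of algebraic cycles", in the shape of the named fact — then for RATIONAL Weil classes
  `w₁ = u₁ + v₁` on `A₁`, `w₂ = u₂ + v₂` on `A₂` whose exterior product `P = p₁^*w₁ ∪ p₂^*w₂` is of
  Hodge type `(n, n)` on `B`, the Weil component `p₁^*u₁ ∪ p₂^*u₂ + p₁^*v₁ ∪ p₂^*v₂` is ALGEBRAIC on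
  `B`. The point is rationality: the Weil component is not a priori a rational class on the carriers
  (that `W_{A₁} ⊗_K W_{A₂} ≅ W_{A₁×A₂}` is defined over `ℚ` needs `H* = ⋀* H¹`), so we do not feed it
  to the hypothesis directly. Instead (proof): pick a test endomorphism `g = x·𝟙_B + ψ` whose
  character values separate the four pieces `P = P₊₊ + P₋₋ + P₊₋ + P₋₊` (`x` exists by
  `eq_zero_of_forall_natCast_add_pow_eq` of `WeilClasses` at the exponent `(2n₁)(2n₂)`), let
  `T = g^*` and `q(X) = (X - β)(X - β̄) ∈ ℚ[X]`, `β = (x+i√d)^{2n₁}(x-i√d)^{2n₂}` the mixed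
  eigenvalue (`β + β̄ ∈ ℤ` by Newton's identities for `x ± i√d`, `ββ̄ = (x² + d)^{2n}`); then
  `Q = q(T)P = q(α)P₊₊ + q(ᾱ)P₋₋` and `TQ` are RATIONAL (`IsRationalClass.map/.cup/.add/.smul`),
  of type `(n,n)` (an endomorphism preserves the `(p,q)`-classes of a fixed Hodge model,
  `HodgeModel.pullback_map_mem_hodgePQ_of_endomorphism`) and in the Weil plane of `B`, hence
  algebraic by hypothesis; and `P₊₊ + P₋₋` is a `ℂ`-combination of `Q` and `TQ`
  (`add_mem_of_smul_add_smul_mem`, `q(α) q(ᾱ) ≠ 0` by the choice of `x`), so it lies in the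
  `ℂ`-subspace `algebraicClasses B.X n`.
* `weilEigencomponents_cupProduct_mem_algebraicClasses` — the sharper form: BOTH eigen-components
  `P₊₊ = p₁^*u₁ ∪ p₂^*u₂` and `P₋₋ = p₁^*v₁ ∪ p₂^*v₂` lie in the `ℂ`-subspace `algebraicClasses B.X n`
  (choose `x` with moreover `α ≠ ᾱ` and invert the `2 × 2` system,
  `mem_and_mem_of_smul_add_smul_mem`); `isOfHodgeType_cupProduct_map_map` and
  `Markman2025_weilClasses_algebraic_abelianFourfold.weilEigencomponents_of_sixfold` spell the
  Hodge-type input through the layer's predicates `PreservesHodgeType`, `CupPreservesHodgeType`.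
* `Markman2025_weilClasses_algebraic_abelianFourfold.weilComponent_of_sixfold` — the case
  `(n₁, n₂) = (2, 1)` in the typing of the named fact: from the sixfold statement for `(B, ψ)`
  (an abelian variety mapping equivariantly to the fourfold `A₁` and to the surface `A₂`; e.g.
  `A₁ × A₂`) to the Weil components on `B` of the Weil classes of `A₁` — the first half of "The
  sixfold is hence of split type and so its Weil classes are algebraic. It follows that the Weil
  classes of `(A₁,η₁,h₁)` are algebraic, by [schoen]".

## What is NOT here (no carrier yet)

The downward half of Schoen's proof — `pr_{A*}(z · (A × D))`, i.e. `P₊₊ + P₋₋ ↦ pr_{1*}((P₊₊ + P₋₋)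
∪ p₂^* w₂') = (∫_{A₂} u₂ ∪ v₂') · u₁ + (∫_{A₂} v₂ ∪ u₂') · v₁` and "`ω_{5,1} ∧ ω_{6,1} ∧ ω_{5,2} ∧
ω_{6,2}` is a basis for `H⁴(A')`" — needs the Gysin push-forward `pr_{1*}` with the projection
formula and the Künneth/degree computation in top degree of `A₂`; in the tree the push-forward on
`complexBetti` is conditional on the Poincaré-duality fact `bijective_poincareDualityMap`
(`ComplexGysin`, `MotivatedClassesProofs.gysinMap_mem_supportedClasses_of_isSmoothProjective`) and
no projection formula / top-degree structure of `H^{2 dim}(A(ℂ))` is available. The statements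
are given for any `B` with equivariant `p₁`, `p₂` (what §11.5 Step 2 needs after an isogeny, cf.
Schoen §10 "leads to an isogeny of Abelian varieties of Weil type `A × A' → (V_ℝ/V_ℤ^N, J)`" and
`WeilClassesIsogenyDescent`) and then specialised to the product `Motives.AbelianVariety.prod A₁ A₂`
with `ψ = φ₁ × φ₂` (section `Product`: `weilEigencomponents_cupProduct_fst_snd_mem_algebraicClasses`,
`Markman2025_weilClasses_algebraic_abelianFourfold.weilEigencomponents_of_product`; `ψ ≫ ψ = -d`
and the exterior products `E±(A₁) ⊠ E±(A₂) ⊆ E±(A₁ × A₂)` for the literal product are also in the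
sibling `WeilClassesFourfoldsProofs`, `prodLift_comp_self_eq_neg_nsmul`,
`cupProduct_map_fst_map_snd_mem_weilClassesPlus`, together with Schoen's transfer `pr_{A*}`
relative to a `GysinFormalism`). The sixfold theorem itself (Markman Thm. 1.5.1) and the
discriminant bookkeeping are untouched (see `WeilClassesFourfoldsProofs`).

## References

* [Schoen1998HodgeWeilAddendum] C. Schoen, Addendum to: Hodge classes on self-products of a variety
  with an automorphism, Compositio Math. 114 (1998) 329–336, §10 (Proposition and proof, pp. 332–333).
* [Markman2025SurveySecant] E. Markman, Secant sheaves and Weil classes on abelian varieties,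
  arXiv:2509.23403, §11.5 Step 2.
* [Markman2025SecantWeil] E. Markman, Cycles on abelian 2n-folds of Weil type from secant sheaves on
  abelian n-folds, arXiv:2502.03415, proof of Cor. 1.6.1.
* [vanGeemen1994HodgeAV] B. van Geemen, An introduction to the Hodge conjecture for abelian
  varieties, LNM 1594 (1994), 4.8–4.9 and proof of Thm. 6.12.
* [HatcherAT2002] A. Hatcher, Algebraic Topology, §3.1 and §3.2 Prop. 3.10.
* [VoisinHodgeI2002] C. Voisin, Hodge Theory and Complex Algebraic Geometry I, §7.3.2.
-/

noncomputable section

open CategoryTheory AlgebraicGeometry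

namespace Literature.AlgebraicGeometry.HodgeTheory

open Literature.AlgebraicTopology.SingularHomology

/-! ### Linear algebra of the rational Weil projector -/

section LinearAlgebra

variable {M : Type*} [AddCommGroup M] [Module ℂ M]

/-- **Extraction from two eigen-combinations.** In a `ℂ`-vector space, if `q(α)·u + q(α')·v` and
`α q(α)·u + α' q(α')·v` lie in a subspace `S` and `q(α), q(α') ≠ 0`, then `u + v ∈ S`: for
`α = α'` the first element is `q(α)·(u + v)`; otherwise the two elements determine `u` and `v`
separately (a `2 × 2` Vandermonde system). [folklore] -/
theorem add_mem_of_smul_add_smul_mem (S : Submodule ℂ M) (q : ℂ → ℂ) {u v : M} {α α' : ℂ}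
    (ha : q α ≠ 0) (ha' : q α' ≠ 0) (h₁ : q α • u + q α' • v ∈ S)
    (h₂ : (α * q α) • u + (α' * q α') • v ∈ S) : u + v ∈ S := by
  by_cases hα : α = α'
  · subst hα
    have e : u + v = (q α)⁻¹ • (q α • u + q α • v) := by
      rw [← smul_add, smul_smul, inv_mul_cancel₀ ha, one_smul]
    rw [e]
    exact S.smul_mem _ h₁
  · have hu : u ∈ S := by
      have e : u = (q α * (α - α'))⁻¹ •
          (((α * q α) • u + (α' * q α') • v) - α' • (q α • u + q α' • v)) := by
        rw [show ((α * q α) • u + (α' * q α') • v) - α' • (q α • u + q α' • v) =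
            (q α * (α - α')) • u by module,
          smul_smul, inv_mul_cancel₀ (mul_ne_zero ha (sub_ne_zero.mpr hα)), one_smul]
      rw [e]
      exact S.smul_mem _ (S.sub_mem h₂ (S.smul_mem _ h₁))
    have hv : v ∈ S := by
      have e : v = (q α' * (α' - α))⁻¹ •
          (((α * q α) • u + (α' * q α') • v) - α • (q α • u + q α' • v)) := by
        rw [show ((α * q α) • u + (α' * q α') • v) - α • (q α • u + q α' • v) =
            (q α' * (α' - α)) • v by module,
          smul_smul, inv_mul_cancel₀ (mul_ne_zero ha' (sub_ne_zero.mpr (Ne.symm hα))), one_smul]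
      rw [e]
      exact S.smul_mem _ (S.sub_mem h₂ (S.smul_mem _ h₁))
    exact S.add_mem hu hv

/-- **Both components from two eigen-combinations with distinct eigenvalues.** If
`a·u + b·v` and `αa·u + α'b·v` lie in a subspace `S`, `a, b ≠ 0` and `α ≠ α'`, then `u ∈ S` and
`v ∈ S` (invert the `2 × 2` Vandermonde system). [folklore] -/
theorem mem_and_mem_of_smul_add_smul_mem (S : Submodule ℂ M) {u v : M} {α α' a b : ℂ}
    (hne : α ≠ α') (ha : a ≠ 0) (hb : b ≠ 0) (h₁ : a • u + b • v ∈ S)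
    (h₂ : (α * a) • u + (α' * b) • v ∈ S) : u ∈ S ∧ v ∈ S := by
  constructor
  · have e : u = (a * (α - α'))⁻¹ • (((α * a) • u + (α' * b) • v) - α' • (a • u + b • v)) := by
      rw [show ((α * a) • u + (α' * b) • v) - α' • (a • u + b • v) = (a * (α - α')) • u by module,
        smul_smul, inv_mul_cancel₀ (mul_ne_zero ha (sub_ne_zero.mpr hne)), one_smul]
    rw [e]
    exact S.smul_mem _ (S.sub_mem h₂ (S.smul_mem _ h₁))
  · have e : v = (b * (α' - α))⁻¹ • (((α * a) • u + (α' * b) • v) - α • (a • u + b • v)) := by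
      rw [show ((α * a) • u + (α' * b) • v) - α • (a • u + b • v) = (b * (α' - α)) • v by module,
        smul_smul, inv_mul_cancel₀ (mul_ne_zero hb (sub_ne_zero.mpr (Ne.symm hne))), one_smul]
    rw [e]
    exact S.smul_mem _ (S.sub_mem h₂ (S.smul_mem _ h₁))

/-- **The projector `q(T) = (T - β)(T - β')` on a sum of four eigenvectors** of a linear map `T`
with eigenvalues `α, α', β, β'`: it kills the `β`- and `β'`-components and multiplies the others by
`q(α) = (α - β)(α - β')`, `q(α')`. [folklore] -/
theorem weilProjector_eq (T : M →ₗ[ℂ] M) {P u₁ u₂ u₃ u₄ : M} {α α' β β' : ℂ}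
    (hP : P = u₁ + u₂ + u₃ + u₄) (h₁ : T u₁ = α • u₁) (h₂ : T u₂ = α' • u₂) (h₃ : T u₃ = β • u₃)
    (h₄ : T u₄ = β' • u₄) :
    T (T P) - (β + β') • T P + (β * β') • P =
      ((α - β) * (α - β')) • u₁ + ((α' - β) * (α' - β')) • u₂ := by
  subst hP
  simp only [map_add, map_smul, h₁, h₂, h₃, h₄, smul_smul]
  module

/-- `T` applied to the projected element: the eigenvalues `α`, `α'` come out once more. [folklore] -/
theorem weilProjector_map_eq (T : M →ₗ[ℂ] M) {P u₁ u₂ u₃ u₄ : M} {α α' β β' : ℂ}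
    (hP : P = u₁ + u₂ + u₃ + u₄) (h₁ : T u₁ = α • u₁) (h₂ : T u₂ = α' • u₂) (h₃ : T u₃ = β • u₃)
    (h₄ : T u₄ = β' • u₄) :
    T (T (T P) - (β + β') • T P + (β * β') • P) =
      (α * ((α - β) * (α - β'))) • u₁ + (α' * ((α' - β) * (α' - β'))) • u₂ := by
  rw [weilProjector_eq T hP h₁ h₂ h₃ h₄, map_add, map_smul, map_smul, h₁, h₂, smul_smul, smul_smul,
    mul_comm ((α - β) * (α - β')) α, mul_comm ((α' - β) * (α' - β')) α']

end LinearAlgebra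

/-! ### Arithmetic of the Weil characters `x ± i√d` -/

section Arithmetic

/-- **Newton's identities for two roots**: if `s + t` and `s·t` are integers, so is every power
sum `sᵏ + tᵏ` (`s^{k+2} + t^{k+2} = (s+t)(s^{k+1} + t^{k+1}) - st(sᵏ + tᵏ)`). Used for
`s, t = x ± i√d`, the values of the two Weil characters at a test endomorphism `x·𝟙 + φ`. [folklore] -/
theorem exists_intCast_eq_pow_add_pow {s t : ℂ} {e₁ e₂ : ℤ} (hs : s + t = e₁) (hp : s * t = e₂)
    (k : ℕ) : ∃ z : ℤ, (z : ℂ) = s ^ k + t ^ k := by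
  suffices H : (∃ z : ℤ, (z : ℂ) = s ^ k + t ^ k) ∧ ∃ z : ℤ, (z : ℂ) = s ^ (k + 1) + t ^ (k + 1) from
    H.1
  induction k with
  | zero => exact ⟨⟨2, by norm_num⟩, e₁, by rw [zero_add, pow_one, pow_one, hs]⟩
  | succ k ih =>
    obtain ⟨⟨b, hb⟩, a, ha⟩ := ih
    refine ⟨⟨a, ha⟩, e₁ * a - e₂ * b, ?_⟩
    push_cast
    rw [ha, hb, ← hs, ← hp]
    ring

/-- The symmetrised mixed products `sᵃ tᵇ + tᵃ sᵇ` are integers as well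
(`= (st)^{min} · (s^{|a-b|} + t^{|a-b|})`). For the Weil characters this is the trace
`β + β̄ ∈ ℤ` of the mixed eigenvalue `β = (x + i√d)^{2n₁} (x - i√d)^{2n₂}`. [folklore] -/
theorem exists_intCast_eq_pow_mul_pow_add {s t : ℂ} {e₁ e₂ : ℤ} (hs : s + t = e₁) (hp : s * t = e₂)
    (a b : ℕ) : ∃ z : ℤ, (z : ℂ) = s ^ a * t ^ b + t ^ a * s ^ b := by
  wlog hab : a ≤ b generalizing a b
  · obtain ⟨z, hz⟩ := this b a (not_le.mp hab).le
    exact ⟨z, by rw [hz]; ring⟩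
  obtain ⟨c, rfl⟩ := Nat.exists_eq_add_of_le hab
  obtain ⟨z, hz⟩ := exists_intCast_eq_pow_add_pow hs hp c
  refine ⟨e₂ ^ a * z, ?_⟩
  push_cast
  rw [hz, ← hp]
  ring

/-- `x + i√d` and `x - i√d` (for `x : ℕ`) have sum `2x` … [folklore] -/
theorem natCast_add_add_natCast_sub (x : ℕ) (a : ℂ) :
    ((x : ℂ) + a) + ((x : ℂ) - a) = ((2 * x : ℤ) : ℂ) := by
  push_cast
  ring

/-- … and product `x² + d`. [folklore] -/
theorem natCast_add_mul_natCast_sub (x d : ℕ) :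
    ((x : ℂ) + Complex.I * (Real.sqrt d : ℂ)) * ((x : ℂ) - Complex.I * (Real.sqrt d : ℂ)) =
      ((x ^ 2 + d : ℤ) : ℂ) := by
  have hsq : ((Real.sqrt d : ℝ) : ℂ) ^ 2 = (d : ℂ) := by
    rw [← Complex.ofReal_pow, Real.sq_sqrt (Nat.cast_nonneg _), Complex.ofReal_natCast]
  push_cast
  linear_combination (-(Real.sqrt d : ℂ) ^ 2) * Complex.I_sq + hsq

/-- `x + i√d ≠ 0` for `d ≥ 1` (its imaginary part is `√d > 0`). [folklore] -/
theorem natCast_add_I_mul_sqrt_ne_zero (x : ℕ) {d : ℕ} (hd : 0 < d) :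
    (x : ℂ) + Complex.I * (Real.sqrt d : ℂ) ≠ 0 := by
  intro h
  have him := congrArg Complex.im h
  simp only [Complex.add_im, Complex.natCast_im, Complex.mul_im, Complex.I_re, Complex.I_im,
    Complex.ofReal_re, Complex.ofReal_im, one_mul, mul_zero, zero_add, Complex.zero_im] at him
  exact (Real.sqrt_pos.mpr (by exact_mod_cast hd)).ne' him

/-- `x - i√d ≠ 0` for `d ≥ 1`. [folklore] -/
theorem natCast_sub_I_mul_sqrt_ne_zero (x : ℕ) {d : ℕ} (hd : 0 < d) :
    (x : ℂ) - Complex.I * (Real.sqrt d : ℂ) ≠ 0 := by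
  intro h
  have him := congrArg Complex.im h
  simp only [Complex.sub_im, Complex.natCast_im, Complex.mul_im, Complex.I_re, Complex.I_im,
    Complex.ofReal_re, Complex.ofReal_im, one_mul, mul_zero, zero_add, zero_sub,
    Complex.zero_im, neg_eq_zero] at him
  exact (Real.sqrt_pos.mpr (by exact_mod_cast hd)).ne' him

/-- **Joint separation of the Weil characters**: for `a ≠ 0` and exponents `m, m' ≥ 1` there is a
natural number `x` with `(x + a)ᵐ ≠ (x - a)ᵐ` AND `(x + a)^{m'} ≠ (x - a)^{m'}` — apply
`eq_zero_of_forall_natCast_add_pow_eq` (file `WeilClasses`) at the exponent `m·m'` and take roots.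
[folklore] -/
theorem exists_nat_pow_ne_and {a : ℂ} (ha : a ≠ 0) {m m' : ℕ} (hm : 0 < m) (hm' : 0 < m') :
    ∃ x : ℕ, ((x : ℂ) + a) ^ m ≠ ((x : ℂ) - a) ^ m ∧ ((x : ℂ) + a) ^ m' ≠ ((x : ℂ) - a) ^ m' := by
  by_contra h
  push Not at h
  refine ha (eq_zero_of_forall_natCast_add_pow_eq (m := m * m') (Nat.mul_pos hm hm') fun x ↦ ?_)
  by_cases hx : ((x : ℂ) + a) ^ m = ((x : ℂ) - a) ^ m
  · rw [pow_mul, pow_mul, hx]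
  · rw [mul_comm, pow_mul, pow_mul, h x hx]

end Arithmetic

section HodgeTheory

variable {A₁ A₂ B : Motives.AbelianVariety ℂ}

/-! ### Cup products of eigenclasses of one abelian variety -/

/-- **Cup products of simultaneous eigenclasses are eigenclasses for the product character**: if
`(x·𝟙 + y·ψ)^* a = χ(x,y)·a` and `(x·𝟙 + y·ψ)^* b = χ'(x,y)·b` for all `x, y`, then
`(x·𝟙 + y·ψ)^* (a ∪ b) = χ(x,y)χ'(x,y)·(a ∪ b)`, by the multiplicativity of pull-backs
(`cupProduct_map`, Hatcher Prop. 3.10). This is the carrier form of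
`⋀ᵃV₊ ⊗ ⋀ᵇV₋ ∧ ⋀ᵃ'V₊ ⊗ ⋀ᵇ'V₋ ⊆ ⋀^{a+a'}V₊ ⊗ ⋀^{b+b'}V₋` in `H*(A) = ⋀*H¹`.
[cite: HatcherAT2002, §3.2 Prop. 3.10] [cite: vanGeemen1994HodgeAV, 4.8–4.9] -/
theorem cupProduct_mem_pullbackEigenclasses {ψ : B ⟶ B} {k l m : ℕ} (h : k + l = m)
    {χ χ' : ℕ → ℕ → ℂ} {a : complexBetti B.X k} {b : complexBetti B.X l}
    (ha : a ∈ pullbackEigenclasses B ψ k χ) (hb : b ∈ pullbackEigenclasses B ψ l χ') :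
    cupProduct h a b ∈ pullbackEigenclasses B ψ m fun x y ↦ χ x y * χ' x y := by
  rw [mem_pullbackEigenclasses_iff] at ha hb ⊢
  intro x y
  rw [cupProduct_map, ha x y, hb x y, LinearMap.map_smul₂, map_smul, smul_smul]

/-- **`E₊(B, n₁) ∪ E₊(B, n₂) ⊆ E₊(B, n₁ + n₂)`**: the cup product of `+`-Weil eigenclasses of
`(B, ψ)` in degrees `2n₁`, `2n₂` is a `+`-Weil eigenclass in degree `2n = 2n₁ + 2n₂`
(`(x + iy√d)^{2n₁} (x + iy√d)^{2n₂} = (x + iy√d)^{2n}`). [cite: vanGeemen1994HodgeAV, 4.9]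
[cite: Schoen1998HodgeWeilAddendum, §10 (proof, bases of W ⊗ ℂ)] -/
theorem cupProduct_mem_weilClassesPlus {ψ : B ⟶ B} {n₁ n₂ n d : ℕ} (h : 2 * n₁ + 2 * n₂ = 2 * n)
    {a : complexBetti B.X (2 * n₁)} {b : complexBetti B.X (2 * n₂)}
    (ha : a ∈ weilClassesPlus B ψ n₁ d) (hb : b ∈ weilClassesPlus B ψ n₂ d) :
    cupProduct h a b ∈ weilClassesPlus B ψ n d := by
  rw [mem_weilClassesPlus_iff] at ha hb ⊢
  intro x y
  rw [cupProduct_map, ha x y, hb x y, LinearMap.map_smul₂, map_smul, smul_smul, ← pow_add, h]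

/-- **`E₋(B, n₁) ∪ E₋(B, n₂) ⊆ E₋(B, n₁ + n₂)`** (the `-`-Weil eigenclasses likewise).
[cite: vanGeemen1994HodgeAV, 4.9] [cite: Schoen1998HodgeWeilAddendum, §10 (proof, bases of W ⊗ ℂ)] -/
theorem cupProduct_mem_weilClassesMinus {ψ : B ⟶ B} {n₁ n₂ n d : ℕ} (h : 2 * n₁ + 2 * n₂ = 2 * n)
    {a : complexBetti B.X (2 * n₁)} {b : complexBetti B.X (2 * n₂)}
    (ha : a ∈ weilClassesMinus B ψ n₁ d) (hb : b ∈ weilClassesMinus B ψ n₂ d) :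
    cupProduct h a b ∈ weilClassesMinus B ψ n d := by
  rw [mem_weilClassesMinus_iff] at ha hb ⊢
  intro x y
  rw [cupProduct_map, ha x y, hb x y, LinearMap.map_smul₂, map_smul, smul_smul, ← pow_add, h]

/-! ### Exterior products along `K`-equivariant homomorphisms (Schoen's bases of `W_{A×A'} ⊗ ℂ`) -/

/-- **`p₁^* E₊(A₁) ∪ p₂^* E₊(A₂) ⊆ E₊(B)`** for `K`-equivariant `p₁ : B ⟶ A₁`, `p₂ : B ⟶ A₂`
(`pᵢ ≫ φᵢ = ψ ≫ pᵢ`; e.g. the projections of `B = A₁ × A₂` with `ψ = φ₁ × φ₂`): Schoen's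
"`W_{A×A'} ⊗ ℂ : {ω_{1,σᵢ} ∧ ⋯ ∧ ω_{6,σᵢ}}`" `= (ω_{1,σᵢ} ∧ ⋯ ∧ ω_{4,σᵢ}) ∧ (ω_{5,σᵢ} ∧ ω_{6,σᵢ})`,
sign `σ₁`. [cite: Schoen1998HodgeWeilAddendum, §10 (proof, p. 333)] [cite: vanGeemen1994HodgeAV, 4.9] -/
theorem cupProduct_map_map_mem_weilClassesPlus {ψ : B ⟶ B} {φ₁ : A₁ ⟶ A₁} {φ₂ : A₂ ⟶ A₂}
    {p₁ : B ⟶ A₁} {p₂ : B ⟶ A₂} (hp₁ : p₁ ≫ φ₁ = ψ ≫ p₁) (hp₂ : p₂ ≫ φ₂ = ψ ≫ p₂)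
    {n₁ n₂ n d : ℕ} (h : 2 * n₁ + 2 * n₂ = 2 * n)
    {w₁ : complexBetti A₁.X (2 * n₁)} {w₂ : complexBetti A₂.X (2 * n₂)}
    (h₁ : w₁ ∈ weilClassesPlus A₁ φ₁ n₁ d) (h₂ : w₂ ∈ weilClassesPlus A₂ φ₂ n₂ d) :
    cupProduct h
        (singularCohomology.map ℂ ℂ (Motives.AlgPoints.mapContinuous (L := ℂ) p₁.hom.hom.hom) (2 * n₁) w₁)
        (singularCohomology.map ℂ ℂ (Motives.AlgPoints.mapContinuous (L := ℂ) p₂.hom.hom.hom) (2 * n₂) w₂) ∈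
      weilClassesPlus B ψ n d :=
  cupProduct_mem_weilClassesPlus h (map_mem_weilClassesPlus_of_comm hp₁ h₁)
    (map_mem_weilClassesPlus_of_comm hp₂ h₂)

/-- **`p₁^* E₋(A₁) ∪ p₂^* E₋(A₂) ⊆ E₋(B)`** (sign `σ₂`).
[cite: Schoen1998HodgeWeilAddendum, §10 (proof, p. 333)] [cite: vanGeemen1994HodgeAV, 4.9] -/
theorem cupProduct_map_map_mem_weilClassesMinus {ψ : B ⟶ B} {φ₁ : A₁ ⟶ A₁} {φ₂ : A₂ ⟶ A₂}
    {p₁ : B ⟶ A₁} {p₂ : B ⟶ A₂} (hp₁ : p₁ ≫ φ₁ = ψ ≫ p₁) (hp₂ : p₂ ≫ φ₂ = ψ ≫ p₂)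
    {n₁ n₂ n d : ℕ} (h : 2 * n₁ + 2 * n₂ = 2 * n)
    {w₁ : complexBetti A₁.X (2 * n₁)} {w₂ : complexBetti A₂.X (2 * n₂)}
    (h₁ : w₁ ∈ weilClassesMinus A₁ φ₁ n₁ d) (h₂ : w₂ ∈ weilClassesMinus A₂ φ₂ n₂ d) :
    cupProduct h
        (singularCohomology.map ℂ ℂ (Motives.AlgPoints.mapContinuous (L := ℂ) p₁.hom.hom.hom) (2 * n₁) w₁)
        (singularCohomology.map ℂ ℂ (Motives.AlgPoints.mapContinuous (L := ℂ) p₂.hom.hom.hom) (2 * n₂) w₂) ∈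
      weilClassesMinus B ψ n d :=
  cupProduct_mem_weilClassesMinus h (map_mem_weilClassesMinus_of_comm hp₁ h₁)
    (map_mem_weilClassesMinus_of_comm hp₂ h₂)

/-- **The mixed exterior products are eigenclasses of the mixed characters**:
`p₁^* a ∪ p₂^* b`, for `a` a `χ`-eigenclass of `(A₁, φ₁)` and `b` a `χ'`-eigenclass of
`(A₂, φ₂)`, is a `χχ'`-eigenclass of `(B, ψ)` — for `a ∈ E₊(A₁, n₁)`, `b ∈ E₋(A₂, n₂)` the character
`(x + iy√d)^{2n₁} (x - iy√d)^{2n₂}`, which is NOT a Weil character of `B` (Schoen's basis of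
`H¹(A × A')` has the further wedges `ω_{·,σ₁} ∧ ω_{·,σ₂}` outside `W_{A×A'} ⊗ ℂ`).
[cite: Schoen1998HodgeWeilAddendum, §10 (proof, p. 333)] [cite: vanGeemen1994HodgeAV, 4.8–4.9] -/
theorem cupProduct_map_map_mem_pullbackEigenclasses {ψ : B ⟶ B} {φ₁ : A₁ ⟶ A₁} {φ₂ : A₂ ⟶ A₂}
    {p₁ : B ⟶ A₁} {p₂ : B ⟶ A₂} (hp₁ : p₁ ≫ φ₁ = ψ ≫ p₁) (hp₂ : p₂ ≫ φ₂ = ψ ≫ p₂)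
    {k l m : ℕ} (h : k + l = m) {χ χ' : ℕ → ℕ → ℂ}
    {a : complexBetti A₁.X k} {b : complexBetti A₂.X l}
    (ha : a ∈ pullbackEigenclasses A₁ φ₁ k χ) (hb : b ∈ pullbackEigenclasses A₂ φ₂ l χ') :
    cupProduct h
        (singularCohomology.map ℂ ℂ (Motives.AlgPoints.mapContinuous (L := ℂ) p₁.hom.hom.hom) k a)
        (singularCohomology.map ℂ ℂ (Motives.AlgPoints.mapContinuous (L := ℂ) p₂.hom.hom.hom) l b) ∈
      pullbackEigenclasses B ψ m fun x y ↦ χ x y * χ' x y :=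
  cupProduct_mem_pullbackEigenclasses h (map_mem_pullbackEigenclasses_of_comm hp₁ ha)
    (map_mem_pullbackEigenclasses_of_comm hp₂ hb)

/-- **The Weil component of an exterior product of Weil classes is a Weil class of `B`**: for
`u₁ ∈ E₊(A₁)`, `v₁ ∈ E₋(A₁)`, `u₂ ∈ E₊(A₂)`, `v₂ ∈ E₋(A₂)` (so `wᵢ = uᵢ + vᵢ` are general elements
of the Weil planes), `p₁^*u₁ ∪ p₂^*u₂ + p₁^*v₁ ∪ p₂^*v₂ ∈ E₊(B) ⊔ E₋(B) = weilClassesOf B ψ n d`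
— the map `W_{A₁} ⊗_K W_{A₂} → W_{A₁ × A₂}` of Schoen's proof, on carriers.
[cite: Schoen1998HodgeWeilAddendum, §10 (proof, p. 333)] -/
theorem weilComponent_mem_weilClassesOf {ψ : B ⟶ B} {φ₁ : A₁ ⟶ A₁} {φ₂ : A₂ ⟶ A₂}
    {p₁ : B ⟶ A₁} {p₂ : B ⟶ A₂} (hp₁ : p₁ ≫ φ₁ = ψ ≫ p₁) (hp₂ : p₂ ≫ φ₂ = ψ ≫ p₂)
    {n₁ n₂ n d : ℕ} (h : 2 * n₁ + 2 * n₂ = 2 * n)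
    {u₁ v₁ : complexBetti A₁.X (2 * n₁)} {u₂ v₂ : complexBetti A₂.X (2 * n₂)}
    (hu₁ : u₁ ∈ weilClassesPlus A₁ φ₁ n₁ d) (hv₁ : v₁ ∈ weilClassesMinus A₁ φ₁ n₁ d)
    (hu₂ : u₂ ∈ weilClassesPlus A₂ φ₂ n₂ d) (hv₂ : v₂ ∈ weilClassesMinus A₂ φ₂ n₂ d) :
    cupProduct h
        (singularCohomology.map ℂ ℂ (Motives.AlgPoints.mapContinuous (L := ℂ) p₁.hom.hom.hom) (2 * n₁) u₁)
        (singularCohomology.map ℂ ℂ (Motives.AlgPoints.mapContinuous (L := ℂ) p₂.hom.hom.hom) (2 * n₂) u₂) +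
      cupProduct h
        (singularCohomology.map ℂ ℂ (Motives.AlgPoints.mapContinuous (L := ℂ) p₁.hom.hom.hom) (2 * n₁) v₁)
        (singularCohomology.map ℂ ℂ (Motives.AlgPoints.mapContinuous (L := ℂ) p₂.hom.hom.hom) (2 * n₂) v₂) ∈
      weilClassesOf B ψ n d :=
  Submodule.add_mem _
    (weilClassesPlus_le_weilClassesOf B ψ n d (cupProduct_map_map_mem_weilClassesPlus hp₁ hp₂ h hu₁ hu₂))
    (weilClassesMinus_le_weilClassesOf B ψ n d (cupProduct_map_map_mem_weilClassesMinus hp₁ hp₂ h hv₁ hv₂))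

/-! ### The upward half of Schoen's Proposition: algebraicity of the Weil component on `B` -/

/-- **Schoen 1998 §10, upward half, on carriers (all dimensions): both Weil eigen-components of
an exterior product of rational Weil classes are algebraic on `B`.** Let `B`, `A₁`, `A₂` be complex
abelian varieties with endomorphisms `ψ`, `φ₁`, `φ₂` and `K`-equivariant homomorphisms
`p₁ : B ⟶ A₁`, `p₂ : B ⟶ A₂` (`pᵢ ≫ φᵢ = ψ ≫ pᵢ`; e.g. `B = A₁ × A₂`), `d, n₁, n₂ ≥ 1`,
`2n₁ + 2n₂ = 2n`, `B` smooth projective of dimension `2n`. ASSUME the conclusion of the printed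
theorem for `(B, ψ)` in the shape of the named fact: every rational class of Hodge type `(n, n)` in
the Weil plane `weilClassesOf B ψ n d` is algebraic ("the Weil cohomology `W_{A×A'}` is generated by
cohomology classes of algebraic cycles"). Then for Weil classes `w₁ = u₁ + v₁` of `(A₁, φ₁)`
(degree `2n₁`) and `w₂ = u₂ + v₂` of `(A₂, φ₂)` (degree `2n₂`), `uᵢ ∈ E₊`, `vᵢ ∈ E₋`, which are
RATIONAL and whose exterior product `P = p₁^* w₁ ∪ p₂^* w₂` is of Hodge type `(n, n)` on `B`, BOTH
eigen-components `P₊₊ = p₁^*u₁ ∪ p₂^*u₂ ∈ E₊(B)` and `P₋₋ = p₁^*v₁ ∪ p₂^*v₂ ∈ E₋(B)` (Schoen's two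
basis vectors `ω_{1,σᵢ} ∧ ⋯ ∧ ω_{6,σᵢ}` of `W_{A×A'} ⊗ ℂ`) lie in the `ℂ`-subspace
`algebraicClasses B.X n = Nⁿ H²ⁿ(B(ℂ); ℂ)` — as they must if `W_{A×A'} ⊆ Nⁿ`, since
`W_{A×A'} ⊗ ℂ = E₊ ⊕ E₋`. Proof in the module docstring: with `T = (x·𝟙 + ψ)^*` for an `x`
separating all the characters involved (including `α = (x+i√d)^{2n} ≠ ᾱ`), the rational Weil
classes `Q = q(T)P = q(α)P₊₊ + q(ᾱ)P₋₋` and `TQ = αq(α)P₊₊ + ᾱq(ᾱ)P₋₋` are algebraic by hypothesis,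
and the `2 × 2` system is inverted over `ℂ` (`mem_and_mem_of_smul_add_smul_mem`).
[cite: Schoen1998HodgeWeilAddendum, §10 (Proposition and proof, pp. 332–333)]
[cite: Markman2025SurveySecant, §11.5 Step 2] -/
theorem weilEigencomponents_cupProduct_mem_algebraicClasses {ψ : B ⟶ B} {φ₁ : A₁ ⟶ A₁} {φ₂ : A₂ ⟶ A₂}
    {p₁ : B ⟶ A₁} {p₂ : B ⟶ A₂} (hp₁ : p₁ ≫ φ₁ = ψ ≫ p₁) (hp₂ : p₂ ≫ φ₂ = ψ ≫ p₂)
    {n₁ n₂ n d : ℕ} (hn₁ : 0 < n₁) (hn₂ : 0 < n₂) (hd : 0 < d) (h : 2 * n₁ + 2 * n₂ = 2 * n)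
    (hBX : Motives.IsSmoothProjective (2 * n) B.X)
    (hB : ∀ c : complexBetti B.X (2 * n), IsRationalClass c →
      IsOfHodgeType (2 * n) B.X (2 * n) n n c → c ∈ weilClassesOf B ψ n d →
        c ∈ algebraicClasses B.X n)
    {u₁ v₁ : complexBetti A₁.X (2 * n₁)} {u₂ v₂ : complexBetti A₂.X (2 * n₂)}
    (hu₁ : u₁ ∈ weilClassesPlus A₁ φ₁ n₁ d) (hv₁ : v₁ ∈ weilClassesMinus A₁ φ₁ n₁ d)
    (hu₂ : u₂ ∈ weilClassesPlus A₂ φ₂ n₂ d) (hv₂ : v₂ ∈ weilClassesMinus A₂ φ₂ n₂ d)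
    (hr₁ : IsRationalClass (u₁ + v₁)) (hr₂ : IsRationalClass (u₂ + v₂))
    (hH : IsOfHodgeType (2 * n) B.X (2 * n) n n (cupProduct h
      (singularCohomology.map ℂ ℂ (Motives.AlgPoints.mapContinuous (L := ℂ) p₁.hom.hom.hom) (2 * n₁)
        (u₁ + v₁))
      (singularCohomology.map ℂ ℂ (Motives.AlgPoints.mapContinuous (L := ℂ) p₂.hom.hom.hom) (2 * n₂)
        (u₂ + v₂)))) :
    cupProduct h
        (singularCohomology.map ℂ ℂ (Motives.AlgPoints.mapContinuous (L := ℂ) p₁.hom.hom.hom) (2 * n₁) u₁)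
        (singularCohomology.map ℂ ℂ (Motives.AlgPoints.mapContinuous (L := ℂ) p₂.hom.hom.hom) (2 * n₂) u₂) ∈
      algebraicClasses B.X n ∧
    cupProduct h
        (singularCohomology.map ℂ ℂ (Motives.AlgPoints.mapContinuous (L := ℂ) p₁.hom.hom.hom) (2 * n₁) v₁)
        (singularCohomology.map ℂ ℂ (Motives.AlgPoints.mapContinuous (L := ℂ) p₂.hom.hom.hom) (2 * n₂) v₂) ∈
      algebraicClasses B.X n := by
  -- shorthands for the pull-backs
  set q₁ : complexBetti A₁.X (2 * n₁) → complexBetti B.X (2 * n₁) := fun w ↦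
    singularCohomology.map ℂ ℂ (Motives.AlgPoints.mapContinuous (L := ℂ) p₁.hom.hom.hom) (2 * n₁) w
    with hq₁
  set q₂ : complexBetti A₂.X (2 * n₂) → complexBetti B.X (2 * n₂) := fun w ↦
    singularCohomology.map ℂ ℂ (Motives.AlgPoints.mapContinuous (L := ℂ) p₂.hom.hom.hom) (2 * n₂) w
    with hq₂
  -- a test endomorphism `g = x·𝟙 + ψ` whose character values separate the four pieces
  have hsq : (Real.sqrt d : ℂ) ≠ 0 := by
    rw [Ne, Complex.ofReal_eq_zero]
    exact (Real.sqrt_pos.mpr (by exact_mod_cast hd)).ne'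
  obtain ⟨x, hx₁₂, hx⟩ := exists_nat_pow_ne_and (mul_ne_zero Complex.I_ne_zero hsq)
    (m := 2 * n₁ * (2 * n₂)) (m' := 2 * n) (Nat.mul_pos (by omega) (by omega)) (by omega)
  set sp : ℂ := (x : ℂ) + Complex.I * (Real.sqrt d : ℂ) with hsp
  set sm : ℂ := (x : ℂ) - Complex.I * (Real.sqrt d : ℂ) with hsm
  have hx₁ : sp ^ (2 * n₁) ≠ sm ^ (2 * n₁) := fun e ↦ hx₁₂ (by rw [pow_mul sp, pow_mul sm, e])
  have hx₂ : sp ^ (2 * n₂) ≠ sm ^ (2 * n₂) := fun e ↦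
    hx₁₂ (by rw [mul_comm (2 * n₁) (2 * n₂), pow_mul sp, pow_mul sm, e])
  have hsp0 : sp ≠ 0 := natCast_add_I_mul_sqrt_ne_zero x hd
  have hsm0 : sm ≠ 0 := natCast_sub_I_mul_sqrt_ne_zero x hd
  set g : B ⟶ B := x • 𝟙 B + (1 : ℕ) • ψ with hg
  set T : complexBetti B.X (2 * n) →ₗ[ℂ] complexBetti B.X (2 * n) :=
    (singularCohomology.map ℂ ℂ (Motives.AlgPoints.mapContinuous (L := ℂ) g.hom.hom.hom) (2 * n)).hom
    with hT
  have hTapp : ∀ c : complexBetti B.X (2 * n), T c =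
      singularCohomology.map ℂ ℂ (Motives.AlgPoints.mapContinuous (L := ℂ) g.hom.hom.hom) (2 * n) c :=
    fun _ ↦ rfl
  -- the four pieces of `P = p₁^* w₁ ∪ p₂^* w₂` and their eigenvalues under `T`
  set P : complexBetti B.X (2 * n) := cupProduct h (q₁ (u₁ + v₁)) (q₂ (u₂ + v₂)) with hPdef
  set P₁ : complexBetti B.X (2 * n) := cupProduct h (q₁ u₁) (q₂ u₂) with hP₁
  set P₂ : complexBetti B.X (2 * n) := cupProduct h (q₁ v₁) (q₂ v₂) with hP₂
  set P₃ : complexBetti B.X (2 * n) := cupProduct h (q₁ u₁) (q₂ v₂) with hP₃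
  set P₄ : complexBetti B.X (2 * n) := cupProduct h (q₁ v₁) (q₂ u₂) with hP₄
  have hP : P = P₁ + P₂ + P₃ + P₄ := by
    simp only [hPdef, hP₁, hP₂, hP₃, hP₄, hq₁, hq₂, map_add, LinearMap.add_apply]
    abel
  have hP₁W : P₁ ∈ weilClassesPlus B ψ n d := cupProduct_map_map_mem_weilClassesPlus hp₁ hp₂ h hu₁ hu₂
  have hP₂W : P₂ ∈ weilClassesMinus B ψ n d :=
    cupProduct_map_map_mem_weilClassesMinus hp₁ hp₂ h hv₁ hv₂
  have hP₃W := cupProduct_map_map_mem_pullbackEigenclasses hp₁ hp₂ h hu₁ hv₂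
  have hP₄W := cupProduct_map_map_mem_pullbackEigenclasses hp₁ hp₂ h hv₁ hu₂
  have e₁ : T P₁ = sp ^ (2 * n) • P₁ := by
    have e := (mem_weilClassesPlus_iff.mp hP₁W) x 1
    simp only [Nat.cast_one, one_mul] at e
    rw [hTapp]
    exact e
  have e₂ : T P₂ = sm ^ (2 * n) • P₂ := by
    have e := (mem_weilClassesMinus_iff.mp hP₂W) x 1
    simp only [Nat.cast_one, one_mul] at e
    rw [hTapp]
    exact e
  have e₃ : T P₃ = (sp ^ (2 * n₁) * sm ^ (2 * n₂)) • P₃ := by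
    have e := (mem_pullbackEigenclasses_iff.mp hP₃W) x 1
    simp only [Nat.cast_one, one_mul] at e
    rw [hTapp]
    exact e
  have e₄ : T P₄ = (sm ^ (2 * n₁) * sp ^ (2 * n₂)) • P₄ := by
    have e := (mem_pullbackEigenclasses_iff.mp hP₄W) x 1
    simp only [Nat.cast_one, one_mul] at e
    rw [hTapp]
    exact e
  -- the eigenvalues and the projector `Q = q(T) P`, `q(X) = (X - β)(X - β')`
  set α : ℂ := sp ^ (2 * n) with hα
  set α' : ℂ := sm ^ (2 * n) with hα'
  set β : ℂ := sp ^ (2 * n₁) * sm ^ (2 * n₂) with hβ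
  set β' : ℂ := sm ^ (2 * n₁) * sp ^ (2 * n₂) with hβ'
  set Q : complexBetti B.X (2 * n) := T (T P) - (β + β') • T P + (β * β') • P with hQdef
  have hQ : Q = ((α - β) * (α - β')) • P₁ + ((α' - β) * (α' - β')) • P₂ := by
    rw [hQdef]
    exact weilProjector_eq T hP e₁ e₂ e₃ e₄
  have hTQ : T Q = (α * ((α - β) * (α - β'))) • P₁ + (α' * ((α' - β) * (α' - β'))) • P₂ := by
    rw [hQdef]
    exact weilProjector_map_eq T hP e₁ e₂ e₃ e₄
  -- `Q` and `TQ` are Weil classes of `B`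
  have hQW : Q ∈ weilClassesOf B ψ n d := by
    rw [hQ]
    exact Submodule.add_mem _
      (weilClassesPlus_le_weilClassesOf B ψ n d (Submodule.smul_mem _ _ hP₁W))
      (weilClassesMinus_le_weilClassesOf B ψ n d (Submodule.smul_mem _ _ hP₂W))
  have hTQW : T Q ∈ weilClassesOf B ψ n d := by
    rw [hTQ]
    exact Submodule.add_mem _
      (weilClassesPlus_le_weilClassesOf B ψ n d (Submodule.smul_mem _ _ hP₁W))
      (weilClassesMinus_le_weilClassesOf B ψ n d (Submodule.smul_mem _ _ hP₂W))
  -- `Q` and `TQ` are rational: `P` is, `T` preserves rationality, `β + β' ∈ ℤ`, `ββ' ∈ ℤ`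
  have hPr : IsRationalClass P := (hr₁.map _).cup h (hr₂.map _)
  have hTPr : IsRationalClass (T P) := by rw [hTapp]; exact hPr.map _
  have hTTPr : IsRationalClass (T (T P)) := by rw [hTapp]; exact hTPr.map _
  have hsum : sp + sm = ((2 * x : ℤ) : ℂ) := natCast_add_add_natCast_sub x _
  have hprod : sp * sm = ((x ^ 2 + d : ℤ) : ℂ) := natCast_add_mul_natCast_sub x d
  obtain ⟨zs, hzs⟩ : ∃ z : ℤ, (z : ℂ) = β + β' :=
    exists_intCast_eq_pow_mul_pow_add hsum hprod (2 * n₁) (2 * n₂)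
  obtain ⟨zt, hzt⟩ : ∃ z : ℤ, (z : ℂ) = β * β' := by
    refine ⟨(x ^ 2 + d) ^ (2 * n₁ + 2 * n₂), ?_⟩
    rw [Int.cast_pow, ← hprod, hβ, hβ']
    ring
  have hQr : IsRationalClass Q := by
    have e : Q = T (T P) + (((-zs : ℤ) : ℚ) : ℂ) • T P + (((zt : ℤ) : ℚ) : ℂ) • P := by
      rw [hQdef, Rat.cast_intCast, Rat.cast_intCast, Int.cast_neg, hzs, hzt, neg_smul,
        ← sub_eq_add_neg]
    rw [e]
    exact (hTTPr.add (hTPr.smul _)).add (hPr.smul _)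
  have hTQr : IsRationalClass (T Q) := by rw [hTapp]; exact hQr.map _
  -- `Q` and `TQ` are of Hodge type `(n, n)`: work in the witness model of `P`
  obtain ⟨M, hM⟩ := hH
  have hstab : ∀ c : complexBetti B.X (2 * n), M.pullback (2 * n) c ∈ M.hodgePQ (2 * n) n n →
      M.pullback (2 * n) (T c) ∈ M.hodgePQ (2 * n) n n := fun c hc ↦ by
    rw [hTapp]
    exact M.pullback_map_mem_hodgePQ_of_endomorphism hBX g.hom.hom.hom hc
  have hMP : P ∈ (M.hodgePQ (2 * n) n n).comap (M.pullback (2 * n)).hom := hM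
  have hMQ : Q ∈ (M.hodgePQ (2 * n) n n).comap (M.pullback (2 * n)).hom := by
    rw [hQdef]
    refine Submodule.add_mem _ (Submodule.sub_mem _ ?_ (Submodule.smul_mem _ _ ?_))
      (Submodule.smul_mem _ _ hMP)
    · exact hstab _ (hstab _ hMP)
    · exact hstab _ hMP
  have hQH : IsOfHodgeType (2 * n) B.X (2 * n) n n Q := ⟨M, hMQ⟩
  have hTQH : IsOfHodgeType (2 * n) B.X (2 * n) n n (T Q) := ⟨M, hstab _ hMQ⟩
  -- hence both are algebraic, and so is `P₁ + P₂`
  have hQalg : Q ∈ algebraicClasses B.X n := hB Q hQr hQH hQW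
  have hTQalg : T Q ∈ algebraicClasses B.X n := hB (T Q) hTQr hTQH hTQW
  rw [hQ] at hQalg
  rw [hTQ] at hTQalg
  have hpow : ∀ s : ℂ, s ^ (2 * n) = s ^ (2 * n₁) * s ^ (2 * n₂) := fun s ↦ by rw [← pow_add, h]
  refine mem_and_mem_of_smul_add_smul_mem (algebraicClasses B.X n) hx ?_ ?_ hQalg hTQalg
  · refine mul_ne_zero ?_ ?_
    · rw [hα, hβ, hpow, ← mul_sub]
      exact mul_ne_zero (pow_ne_zero _ hsp0) (sub_ne_zero.mpr hx₂)
    · rw [hα, hβ', hpow, ← sub_mul]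
      exact mul_ne_zero (sub_ne_zero.mpr hx₁) (pow_ne_zero _ hsp0)
  · refine mul_ne_zero ?_ ?_
    · rw [hα', hβ, hpow, ← sub_mul]
      exact mul_ne_zero (sub_ne_zero.mpr hx₁.symm) (pow_ne_zero _ hsm0)
    · rw [hα', hβ', hpow, ← mul_sub]
      exact mul_ne_zero (pow_ne_zero _ hsm0) (sub_ne_zero.mpr hx₂.symm)

/-- **Schoen 1998 §10, upward half, on carriers (all dimensions).** Let `B`, `A₁`, `A₂` be complex
abelian varieties with endomorphisms `ψ`, `φ₁`, `φ₂` and `K`-equivariant homomorphisms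
`p₁ : B ⟶ A₁`, `p₂ : B ⟶ A₂` (`pᵢ ≫ φᵢ = ψ ≫ pᵢ`; e.g. `B = A₁ × A₂`), `d, n₁, n₂ ≥ 1`,
`2n₁ + 2n₂ = 2n`, `B` smooth projective of dimension `2n`. ASSUME the conclusion of the printed
theorem for `(B, ψ)` in the shape of the named fact: every rational class of Hodge type `(n, n)` in
the Weil plane `weilClassesOf B ψ n d` is algebraic ("the Weil cohomology `W_{A×A'}` is generated by
cohomology classes of algebraic cycles"). Then for Weil classes `w₁ = u₁ + v₁` of `(A₁, φ₁)`
(degree `2n₁`) and `w₂ = u₂ + v₂` of `(A₂, φ₂)` (degree `2n₂`), `uᵢ ∈ E₊`, `vᵢ ∈ E₋`, which are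
RATIONAL and whose exterior product `p₁^* w₁ ∪ p₂^* w₂` is of Hodge type `(n, n)` on `B`, the Weil
component `p₁^*u₁ ∪ p₂^*u₂ + p₁^*v₁ ∪ p₂^*v₂` (an element of `W_{A×A'} ⊗ ℂ`) is ALGEBRAIC on `B`.
Proof in the module docstring (rational projector `q(T)`, `T = (x·𝟙 + ψ)^*`).
[cite: Schoen1998HodgeWeilAddendum, §10 (Proposition and proof, pp. 332–333)]
[cite: Markman2025SurveySecant, §11.5 Step 2] -/
theorem weilComponent_cupProduct_mem_algebraicClasses {ψ : B ⟶ B} {φ₁ : A₁ ⟶ A₁} {φ₂ : A₂ ⟶ A₂}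
    {p₁ : B ⟶ A₁} {p₂ : B ⟶ A₂} (hp₁ : p₁ ≫ φ₁ = ψ ≫ p₁) (hp₂ : p₂ ≫ φ₂ = ψ ≫ p₂)
    {n₁ n₂ n d : ℕ} (hn₁ : 0 < n₁) (hn₂ : 0 < n₂) (hd : 0 < d) (h : 2 * n₁ + 2 * n₂ = 2 * n)
    (hBX : Motives.IsSmoothProjective (2 * n) B.X)
    (hB : ∀ c : complexBetti B.X (2 * n), IsRationalClass c →
      IsOfHodgeType (2 * n) B.X (2 * n) n n c → c ∈ weilClassesOf B ψ n d →
        c ∈ algebraicClasses B.X n)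
    {u₁ v₁ : complexBetti A₁.X (2 * n₁)} {u₂ v₂ : complexBetti A₂.X (2 * n₂)}
    (hu₁ : u₁ ∈ weilClassesPlus A₁ φ₁ n₁ d) (hv₁ : v₁ ∈ weilClassesMinus A₁ φ₁ n₁ d)
    (hu₂ : u₂ ∈ weilClassesPlus A₂ φ₂ n₂ d) (hv₂ : v₂ ∈ weilClassesMinus A₂ φ₂ n₂ d)
    (hr₁ : IsRationalClass (u₁ + v₁)) (hr₂ : IsRationalClass (u₂ + v₂))
    (hH : IsOfHodgeType (2 * n) B.X (2 * n) n n (cupProduct h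
      (singularCohomology.map ℂ ℂ (Motives.AlgPoints.mapContinuous (L := ℂ) p₁.hom.hom.hom) (2 * n₁)
        (u₁ + v₁))
      (singularCohomology.map ℂ ℂ (Motives.AlgPoints.mapContinuous (L := ℂ) p₂.hom.hom.hom) (2 * n₂)
        (u₂ + v₂)))) :
    cupProduct h
        (singularCohomology.map ℂ ℂ (Motives.AlgPoints.mapContinuous (L := ℂ) p₁.hom.hom.hom) (2 * n₁) u₁)
        (singularCohomology.map ℂ ℂ (Motives.AlgPoints.mapContinuous (L := ℂ) p₂.hom.hom.hom) (2 * n₂) u₂) +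
      cupProduct h
        (singularCohomology.map ℂ ℂ (Motives.AlgPoints.mapContinuous (L := ℂ) p₁.hom.hom.hom) (2 * n₁) v₁)
        (singularCohomology.map ℂ ℂ (Motives.AlgPoints.mapContinuous (L := ℂ) p₂.hom.hom.hom) (2 * n₂) v₂) ∈
      algebraicClasses B.X n := by
  have H := weilEigencomponents_cupProduct_mem_algebraicClasses hp₁ hp₂ hn₁ hn₂ hd h hBX hB hu₁ hv₁
    hu₂ hv₂ hr₁ hr₂ hH
  exact Submodule.add_mem _ H.1 H.2

/-- **The case of the named fact (`n₁ = 2`, `n₂ = 1`): from Weil-type sixfolds to the Weil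
components of the Weil classes of a fourfold** — the first half of Markman's §11.5 Step 2 / of
Schoen's Proposition, in the typing of `Markman2025_weilClasses_algebraic_abelianFourfold`: if the
conclusion of the named fact's sixfold analogue holds for `(B, ψ)` (`B` of dimension `6`, mapping
`K`-equivariantly to the fourfold `A₁` and to the surface `A₂`, e.g. `B = A₁ × A₂` or an isogenous
abelian variety), then for every rational Weil class `w₁ = u₁ + v₁` of the fourfold `(A₁, φ₁)` and
every rational Weil class `w₂ = u₂ + v₂` of the surface `(A₂, φ₂)` with `p₁^*w₁ ∪ p₂^*w₂` of Hodge
type `(3,3)`, the class `p₁^*u₁ ∪ p₂^*u₂ + p₁^*v₁ ∪ p₂^*v₂ ∈ H⁶(B(ℂ); ℂ)` is algebraic. (The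
remaining half — `pr_{A₁*}` of its product with `p₂^*` of a second Weil class of `A₂` is a non-zero
rational multiple of `w₁` — is the part of Schoen's proof without carrier, module docstring.)
[cite: Markman2025SurveySecant, §11.5 Step 2] [cite: Schoen1998HodgeWeilAddendum, §10] -/
theorem Markman2025_weilClasses_algebraic_abelianFourfold.weilComponent_of_sixfold {d : ℕ}
    (hd : 0 < d) {ψ : B ⟶ B} {φ₁ : A₁ ⟶ A₁} {φ₂ : A₂ ⟶ A₂} {p₁ : B ⟶ A₁} {p₂ : B ⟶ A₂}
    (hp₁ : p₁ ≫ φ₁ = ψ ≫ p₁) (hp₂ : p₂ ≫ φ₂ = ψ ≫ p₂)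
    (hBX : Motives.IsSmoothProjective (2 * 3) B.X)
    (hB : ∀ c : singularCohomology ℂ ℂ (Motives.ComplexPoints B.X) (2 * 3), IsRationalClass c →
      IsOfHodgeType (2 * 3) B.X (2 * 3) 3 3 c → c ∈ weilClassesOf B ψ 3 d →
        c ∈ algebraicClasses B.X 3)
    {u₁ v₁ : complexBetti A₁.X (2 * 2)} {u₂ v₂ : complexBetti A₂.X (2 * 1)}
    (hu₁ : u₁ ∈ weilClassesPlus A₁ φ₁ 2 d) (hv₁ : v₁ ∈ weilClassesMinus A₁ φ₁ 2 d)
    (hu₂ : u₂ ∈ weilClassesPlus A₂ φ₂ 1 d) (hv₂ : v₂ ∈ weilClassesMinus A₂ φ₂ 1 d)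
    (hr₁ : IsRationalClass (u₁ + v₁)) (hr₂ : IsRationalClass (u₂ + v₂))
    (hH : IsOfHodgeType (2 * 3) B.X (2 * 3) 3 3 (cupProduct (show 2 * 2 + 2 * 1 = 2 * 3 by rfl)
      (singularCohomology.map ℂ ℂ (Motives.AlgPoints.mapContinuous (L := ℂ) p₁.hom.hom.hom) (2 * 2)
        (u₁ + v₁))
      (singularCohomology.map ℂ ℂ (Motives.AlgPoints.mapContinuous (L := ℂ) p₂.hom.hom.hom) (2 * 1)
        (u₂ + v₂)))) :
    cupProduct (show 2 * 2 + 2 * 1 = 2 * 3 by rfl)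
        (singularCohomology.map ℂ ℂ (Motives.AlgPoints.mapContinuous (L := ℂ) p₁.hom.hom.hom) (2 * 2) u₁)
        (singularCohomology.map ℂ ℂ (Motives.AlgPoints.mapContinuous (L := ℂ) p₂.hom.hom.hom) (2 * 1) u₂) +
      cupProduct (show 2 * 2 + 2 * 1 = 2 * 3 by rfl)
        (singularCohomology.map ℂ ℂ (Motives.AlgPoints.mapContinuous (L := ℂ) p₁.hom.hom.hom) (2 * 2) v₁)
        (singularCohomology.map ℂ ℂ (Motives.AlgPoints.mapContinuous (L := ℂ) p₂.hom.hom.hom) (2 * 1) v₂) ∈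
      algebraicClasses B.X 3 :=
  weilComponent_cupProduct_mem_algebraicClasses hp₁ hp₂ (by norm_num) (by norm_num) hd _ hBX hB
    hu₁ hv₁ hu₂ hv₂ hr₁ hr₂ hH

/-! ### The Hodge-type input from the layer's standard predicates -/

/-- **The exterior product of an `(n₁, n₁)`-class and an `(n₂, n₂)`-class is an `(n, n)`-class**,
`n = n₁ + n₂`, granted that `p₁^*`, `p₂^*` are morphisms of Hodge structures and that the cup
product of `B` respects the Hodge bigrading — the layer's hypothesis predicates `PreservesHodgeType`
and `CupPreservesHodgeType` (`GysinFormalismHodge`; Voisin I §7.3.2, §7.1.2). The former is PROVED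
in the tree when `dim B ≤ dim Aᵢ` (`IsOfHodgeType.map_of_le`), which is never the case for the
projections of a product; the latter is not proved in the tree. [cite: VoisinHodgeI2002, §7.3.2 and §7.1.2] -/
theorem isOfHodgeType_cupProduct_map_map {p₁ : B ⟶ A₁} {p₂ : B ⟶ A₂} {n₁ n₂ n : ℕ}
    (h : 2 * n₁ + 2 * n₂ = 2 * n) (hp₁H : PreservesHodgeType (2 * n) (2 * n₁) p₁.hom.hom.hom)
    (hp₂H : PreservesHodgeType (2 * n) (2 * n₂) p₂.hom.hom.hom)
    (hcupH : CupPreservesHodgeType (2 * n) B.X)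
    {w₁ : complexBetti A₁.X (2 * n₁)} {w₂ : complexBetti A₂.X (2 * n₂)}
    (hw₁ : IsOfHodgeType (2 * n₁) A₁.X (2 * n₁) n₁ n₁ w₁)
    (hw₂ : IsOfHodgeType (2 * n₂) A₂.X (2 * n₂) n₂ n₂ w₂) :
    IsOfHodgeType (2 * n) B.X (2 * n) n n (cupProduct h
      (singularCohomology.map ℂ ℂ (Motives.AlgPoints.mapContinuous (L := ℂ) p₁.hom.hom.hom) (2 * n₁) w₁)
      (singularCohomology.map ℂ ℂ (Motives.AlgPoints.mapContinuous (L := ℂ) p₂.hom.hom.hom) (2 * n₂) w₂)) := by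
  have hn : n₁ + n₂ = n := by omega
  have H := hcupH h (hp₁H hw₁) (hp₂H hw₂)
  rwa [hn] at H

/-- **From Weil-type sixfolds to the fourfold's Weil classes, first half, with the Hodge-type
bookkeeping spelled by the layer's predicates** (the case `n₁ = 2`, `n₂ = 1`): given the conclusion
of the named fact's sixfold analogue for `(B, ψ)` (`B` mapping `K`-equivariantly to the fourfold
`A₁` and the surface `A₂`, `p₁^*`, `p₂^*` and `∪` compatible with Hodge types), a RATIONAL
`(2,2)`-CLASS `w₁ = u₁ + v₁` IN THE WEIL PLANE OF THE FOURFOLD `(A₁, φ₁)` — literally the class `c`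
of `Markman2025_weilClasses_algebraic_abelianFourfold` — and a rational `(1,1)` Weil class
`w₂ = u₂ + v₂` of the surface `(A₂, φ₂)` (for `A₂` of Weil type all its Weil classes are `(1,1)`,
Schoen: "`W_{A'}` has Hodge type `(1,1)`"), both classes `p₁^*u₁ ∪ p₂^*u₂`, `p₁^*v₁ ∪ p₂^*v₂` are
algebraic on `B`. What remains of §11.5 Step 2 after this is Schoen's `pr_{A*}` (module docstring)
and the choice of `(A₂, φ₂)` making `A₁ × A₂` of split type.
[cite: Markman2025SurveySecant, §11.5 Step 2] [cite: Schoen1998HodgeWeilAddendum, §10] -/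
theorem Markman2025_weilClasses_algebraic_abelianFourfold.weilEigencomponents_of_sixfold {d : ℕ}
    (hd : 0 < d) {ψ : B ⟶ B} {φ₁ : A₁ ⟶ A₁} {φ₂ : A₂ ⟶ A₂} {p₁ : B ⟶ A₁} {p₂ : B ⟶ A₂}
    (hp₁ : p₁ ≫ φ₁ = ψ ≫ p₁) (hp₂ : p₂ ≫ φ₂ = ψ ≫ p₂)
    (hBX : Motives.IsSmoothProjective (2 * 3) B.X)
    (hB : ∀ c : singularCohomology ℂ ℂ (Motives.ComplexPoints B.X) (2 * 3), IsRationalClass c →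
      IsOfHodgeType (2 * 3) B.X (2 * 3) 3 3 c → c ∈ weilClassesOf B ψ 3 d →
        c ∈ algebraicClasses B.X 3)
    (hp₁H : PreservesHodgeType (2 * 3) (2 * 2) p₁.hom.hom.hom)
    (hp₂H : PreservesHodgeType (2 * 3) (2 * 1) p₂.hom.hom.hom)
    (hcupH : CupPreservesHodgeType (2 * 3) B.X)
    {u₁ v₁ : complexBetti A₁.X (2 * 2)} {u₂ v₂ : complexBetti A₂.X (2 * 1)}
    (hu₁ : u₁ ∈ weilClassesPlus A₁ φ₁ 2 d) (hv₁ : v₁ ∈ weilClassesMinus A₁ φ₁ 2 d)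
    (hu₂ : u₂ ∈ weilClassesPlus A₂ φ₂ 1 d) (hv₂ : v₂ ∈ weilClassesMinus A₂ φ₂ 1 d)
    (hr₁ : IsRationalClass (u₁ + v₁)) (hw₁ : IsOfHodgeType (2 * 2) A₁.X (2 * 2) 2 2 (u₁ + v₁))
    (hr₂ : IsRationalClass (u₂ + v₂)) (hw₂ : IsOfHodgeType (2 * 1) A₂.X (2 * 1) 1 1 (u₂ + v₂)) :
    cupProduct (show 2 * 2 + 2 * 1 = 2 * 3 by rfl)
        (singularCohomology.map ℂ ℂ (Motives.AlgPoints.mapContinuous (L := ℂ) p₁.hom.hom.hom) (2 * 2) u₁)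
        (singularCohomology.map ℂ ℂ (Motives.AlgPoints.mapContinuous (L := ℂ) p₂.hom.hom.hom) (2 * 1) u₂) ∈
      algebraicClasses B.X 3 ∧
    cupProduct (show 2 * 2 + 2 * 1 = 2 * 3 by rfl)
        (singularCohomology.map ℂ ℂ (Motives.AlgPoints.mapContinuous (L := ℂ) p₁.hom.hom.hom) (2 * 2) v₁)
        (singularCohomology.map ℂ ℂ (Motives.AlgPoints.mapContinuous (L := ℂ) p₂.hom.hom.hom) (2 * 1) v₂) ∈
      algebraicClasses B.X 3 :=
  weilEigencomponents_cupProduct_mem_algebraicClasses hp₁ hp₂ (by norm_num) (by norm_num) hd _ hBX hB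
    hu₁ hv₁ hu₂ hv₂ hr₁ hr₂ (isOfHodgeType_cupProduct_map_map _ hp₁H hp₂H hcupH hw₁ hw₂)

/-! ### The product `A₁ × A₂` itself (Markman: "their product polarized abelian sixfold of Weil type") -/

section Product

variable (A₁ A₂)

/-- The diagonal complex multiplication `ψ = φ₁ × φ₂ = (fst ≫ φ₁, snd ≫ φ₂)` of `A₁ × A₂`
(`Motives.AbelianVariety.prod`, with its projections `fst`, `snd`) is intertwined with `φ₁` by the
first projection: `fst ≫ φ₁ = ψ ≫ fst`. (Markman §11.5 Step 2: the product `(A₁ × A₂, η, …)` with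
`η` the diagonal embedding of `K`.) [cite: Markman2025SurveySecant, §11.5 Step 2] -/
theorem prod_fst_comm (φ₁ : A₁ ⟶ A₁) (φ₂ : A₂ ⟶ A₂) :
    Motives.AbelianVariety.fst A₁ A₂ ≫ φ₁ =
      Motives.AbelianVariety.prodLift (Motives.AbelianVariety.fst A₁ A₂ ≫ φ₁)
          (Motives.AbelianVariety.snd A₁ A₂ ≫ φ₂) ≫ Motives.AbelianVariety.fst A₁ A₂ :=
  (Motives.AbelianVariety.prodLift_fst _ _).symm

/-- … and with `φ₂` by the second projection: `snd ≫ φ₂ = ψ ≫ snd`.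
[cite: Markman2025SurveySecant, §11.5 Step 2] -/
theorem prod_snd_comm (φ₁ : A₁ ⟶ A₁) (φ₂ : A₂ ⟶ A₂) :
    Motives.AbelianVariety.snd A₁ A₂ ≫ φ₂ =
      Motives.AbelianVariety.prodLift (Motives.AbelianVariety.fst A₁ A₂ ≫ φ₁)
          (Motives.AbelianVariety.snd A₁ A₂ ≫ φ₂) ≫ Motives.AbelianVariety.snd A₁ A₂ :=
  (Motives.AbelianVariety.prodLift_snd _ _).symm

variable {A₁ A₂}

/-- **Schoen's upward half for the product `A₁ × A₂` itself** (all dimensions): with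
`ψ = φ₁ × φ₂`, if every rational `(n, n)`-class in the Weil plane of `(A₁ × A₂, ψ)` is algebraic,
then for rational Weil classes `w₁ = u₁ + v₁` of `A₁`, `w₂ = u₂ + v₂` of `A₂` with
`pr₁^* w₁ ∪ pr₂^* w₂` of type `(n, n)`, both `pr₁^*u₁ ∪ pr₂^*u₂` and `pr₁^*v₁ ∪ pr₂^*v₂` are
algebraic on `A₁ × A₂` (`weilEigencomponents_cupProduct_mem_algebraicClasses` for `B = A₁ × A₂`,
`p₁ = fst`, `p₂ = snd`, smooth projective by the Segre embedding).
[cite: Schoen1998HodgeWeilAddendum, §10 (Proposition and proof, pp. 332–333)]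
[cite: Markman2025SurveySecant, §11.5 Step 2] -/
theorem weilEigencomponents_cupProduct_fst_snd_mem_algebraicClasses {φ₁ : A₁ ⟶ A₁} {φ₂ : A₂ ⟶ A₂}
    {n₁ n₂ n d : ℕ} (hn₁ : 0 < n₁) (hn₂ : 0 < n₂) (hd : 0 < d) (h : 2 * n₁ + 2 * n₂ = 2 * n)
    (hA₁ : Motives.IsSmoothProjective (2 * n₁) A₁.X) (hA₂ : Motives.IsSmoothProjective (2 * n₂) A₂.X)
    (hB : ∀ c : complexBetti (A₁.prod A₂).X (2 * n), IsRationalClass c →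
      IsOfHodgeType (2 * n) (A₁.prod A₂).X (2 * n) n n c →
        c ∈ weilClassesOf (A₁.prod A₂)
          (Motives.AbelianVariety.prodLift (Motives.AbelianVariety.fst A₁ A₂ ≫ φ₁)
            (Motives.AbelianVariety.snd A₁ A₂ ≫ φ₂)) n d →
        c ∈ algebraicClasses (A₁.prod A₂).X n)
    {u₁ v₁ : complexBetti A₁.X (2 * n₁)} {u₂ v₂ : complexBetti A₂.X (2 * n₂)}
    (hu₁ : u₁ ∈ weilClassesPlus A₁ φ₁ n₁ d) (hv₁ : v₁ ∈ weilClassesMinus A₁ φ₁ n₁ d)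
    (hu₂ : u₂ ∈ weilClassesPlus A₂ φ₂ n₂ d) (hv₂ : v₂ ∈ weilClassesMinus A₂ φ₂ n₂ d)
    (hr₁ : IsRationalClass (u₁ + v₁)) (hr₂ : IsRationalClass (u₂ + v₂))
    (hH : IsOfHodgeType (2 * n) (A₁.prod A₂).X (2 * n) n n (cupProduct h
      (singularCohomology.map ℂ ℂ (Motives.AlgPoints.mapContinuous (L := ℂ)
        (Motives.AbelianVariety.fst A₁ A₂).hom.hom.hom) (2 * n₁) (u₁ + v₁))
      (singularCohomology.map ℂ ℂ (Motives.AlgPoints.mapContinuous (L := ℂ)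
        (Motives.AbelianVariety.snd A₁ A₂).hom.hom.hom) (2 * n₂) (u₂ + v₂)))) :
    cupProduct h
        (singularCohomology.map ℂ ℂ (Motives.AlgPoints.mapContinuous (L := ℂ)
          (Motives.AbelianVariety.fst A₁ A₂).hom.hom.hom) (2 * n₁) u₁)
        (singularCohomology.map ℂ ℂ (Motives.AlgPoints.mapContinuous (L := ℂ)
          (Motives.AbelianVariety.snd A₁ A₂).hom.hom.hom) (2 * n₂) u₂) ∈
      algebraicClasses (A₁.prod A₂).X n ∧
    cupProduct h
        (singularCohomology.map ℂ ℂ (Motives.AlgPoints.mapContinuous (L := ℂ)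
          (Motives.AbelianVariety.fst A₁ A₂).hom.hom.hom) (2 * n₁) v₁)
        (singularCohomology.map ℂ ℂ (Motives.AlgPoints.mapContinuous (L := ℂ)
          (Motives.AbelianVariety.snd A₁ A₂).hom.hom.hom) (2 * n₂) v₂) ∈
      algebraicClasses (A₁.prod A₂).X n :=
  weilEigencomponents_cupProduct_mem_algebraicClasses (prod_fst_comm A₁ A₂ φ₁ φ₂)
    (prod_snd_comm A₁ A₂ φ₁ φ₂) hn₁ hn₂ hd h (h ▸ Motives.IsSmoothProjective.tensor_holds hA₁ hA₂) hB
    hu₁ hv₁ hu₂ hv₂ hr₁ hr₂ hH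

/-- **Markman §11.5 Step 2 for the product sixfold `A₁ × A₂`, first half, in the typing of the
named fact**: `A₁` an abelian FOURFOLD with `φ₁` (the fact's `(A, φ)`), `A₂` an abelian SURFACE with
`φ₂`, `ψ = φ₁ × φ₂` on the sixfold `A₁ × A₂`. If the rational `(3,3)`-classes of the Weil plane of
`(A₁ × A₂, ψ)` are algebraic ("The sixfold is hence of split type and so its Weil classes are
algebraic"), `pr₁^*`, `pr₂^*`, `∪` respect Hodge types, `c = u₁ + v₁` is a rational
`(2,2)`-class in the Weil plane of `(A₁, φ₁)` and `w₂ = u₂ + v₂` a rational `(1,1)` Weil class of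
`(A₂, φ₂)`, then `pr₁^*u₁ ∪ pr₂^*u₂` and `pr₁^*v₁ ∪ pr₂^*v₂` are algebraic on `A₁ × A₂`. The step
"It follows that the Weil classes of `(A₁,η₁,h₁)` are algebraic, by [schoen]" then needs only
Schoen's `pr_{A₁*}` (module docstring, "What is NOT here").
[cite: Markman2025SurveySecant, §11.5 Step 2] [cite: Schoen1998HodgeWeilAddendum, §10] -/
theorem Markman2025_weilClasses_algebraic_abelianFourfold.weilEigencomponents_of_product {d : ℕ}
    (hd : 0 < d) {φ₁ : A₁ ⟶ A₁} {φ₂ : A₂ ⟶ A₂}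
    (hA₁ : Motives.IsSmoothProjective (2 * 2) A₁.X) (hA₂ : Motives.IsSmoothProjective (2 * 1) A₂.X)
    (hB : ∀ c : singularCohomology ℂ ℂ (Motives.ComplexPoints (A₁.prod A₂).X) (2 * 3),
      IsRationalClass c → IsOfHodgeType (2 * 3) (A₁.prod A₂).X (2 * 3) 3 3 c →
        c ∈ weilClassesOf (A₁.prod A₂)
          (Motives.AbelianVariety.prodLift (Motives.AbelianVariety.fst A₁ A₂ ≫ φ₁)
            (Motives.AbelianVariety.snd A₁ A₂ ≫ φ₂)) 3 d →
        c ∈ algebraicClasses (A₁.prod A₂).X 3)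
    (hp₁H : PreservesHodgeType (2 * 3) (2 * 2) (Motives.AbelianVariety.fst A₁ A₂).hom.hom.hom)
    (hp₂H : PreservesHodgeType (2 * 3) (2 * 1) (Motives.AbelianVariety.snd A₁ A₂).hom.hom.hom)
    (hcupH : CupPreservesHodgeType (2 * 3) (A₁.prod A₂).X)
    {u₁ v₁ : complexBetti A₁.X (2 * 2)} {u₂ v₂ : complexBetti A₂.X (2 * 1)}
    (hu₁ : u₁ ∈ weilClassesPlus A₁ φ₁ 2 d) (hv₁ : v₁ ∈ weilClassesMinus A₁ φ₁ 2 d)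
    (hu₂ : u₂ ∈ weilClassesPlus A₂ φ₂ 1 d) (hv₂ : v₂ ∈ weilClassesMinus A₂ φ₂ 1 d)
    (hr₁ : IsRationalClass (u₁ + v₁)) (hw₁ : IsOfHodgeType (2 * 2) A₁.X (2 * 2) 2 2 (u₁ + v₁))
    (hr₂ : IsRationalClass (u₂ + v₂)) (hw₂ : IsOfHodgeType (2 * 1) A₂.X (2 * 1) 1 1 (u₂ + v₂)) :
    cupProduct (show 2 * 2 + 2 * 1 = 2 * 3 by rfl)
        (singularCohomology.map ℂ ℂ (Motives.AlgPoints.mapContinuous (L := ℂ)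
          (Motives.AbelianVariety.fst A₁ A₂).hom.hom.hom) (2 * 2) u₁)
        (singularCohomology.map ℂ ℂ (Motives.AlgPoints.mapContinuous (L := ℂ)
          (Motives.AbelianVariety.snd A₁ A₂).hom.hom.hom) (2 * 1) u₂) ∈
      algebraicClasses (A₁.prod A₂).X 3 ∧
    cupProduct (show 2 * 2 + 2 * 1 = 2 * 3 by rfl)
        (singularCohomology.map ℂ ℂ (Motives.AlgPoints.mapContinuous (L := ℂ)
          (Motives.AbelianVariety.fst A₁ A₂).hom.hom.hom) (2 * 2) v₁)
        (singularCohomology.map ℂ ℂ (Motives.AlgPoints.mapContinuous (L := ℂ)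
          (Motives.AbelianVariety.snd A₁ A₂).hom.hom.hom) (2 * 1) v₂) ∈
      algebraicClasses (A₁.prod A₂).X 3 :=
  weilEigencomponents_cupProduct_fst_snd_mem_algebraicClasses (by norm_num) (by norm_num) hd _ hA₁
    hA₂ hB hu₁ hv₁ hu₂ hv₂ hr₁ hr₂ (isOfHodgeType_cupProduct_map_map _ hp₁H hp₂H hcupH hw₁ hw₂)

end Product

end HodgeTheory

end Literature.AlgebraicGeometry.HodgeTheory

end
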